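import Summits.SmoothPoincare4.SmoothPoincare4.Theorems.SullivanDualWitnessChargeDefs
import Mathlib.Analysis.Calculus.Deriv.Slope
import Mathlib.Analysis.Calculus.FDeriv.RestrictScalars

/-!
# Intercept chart of a local family — holomorphy in the cap chart and the simple zero of `t`
(crux `WitnessCharge`, stmt-SmoothPoincare4-7824, line `Sketch`, skeleton v15, stub
`stub_interceptChart`, lead c8)

Two registered helpers of stub S5 `stub_interceptChart`, stated WITHOUT the cap-model structure
`CapData` (generic over its fields) so that they land independently of it:

* `helper_interceptChart_slope` — the first-order behaviour of the `t = z⁻¹`-coordinate along the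
  `w`-chart of a compactified member at an admissible scale `lam ≥ 4`: if `t 0 = 0` and
  `t w = (z (lam / w))⁻¹` for `0 < ‖w‖ < 1`, where `‖z ξ − ξ‖ ≤ 1` for `‖ξ‖ ≥ lam / 2`, then
  `t` has complex derivative `lam⁻¹ ≠ 0` at `0` (`w · z(lam / w) = lam + w · (z ξ − ξ) → lam`).
* `helper_interceptChart_capHolo` — **`JX`-holomorphic curves are holomorphic in the cap chart**:
  on a `4`-manifold `X` with a "cap chart" `capInv : dom → X` (a local diffeomorphism onto an open
  set, inverse `capCoord`, `d capCoord ∘ d capInv = id`) in which the endomorphism field `JX` is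
  multiplication by `i` (`JX (d capInv v) = d capInv (i v)`), a `C^∞` `JX`-holomorphic curve
  `γ : s → capInv(dom)` (`s ⊆ ℂ` open) has COMPLEX differentiable coordinate expression
  `capCoord ∘ γ` on `s` (its real derivative commutes with `i`, hence is complex linear —
  `Literature.Geometry.Symplectic.exists_restrictScalars_eq_of_map_mul_I`).
-/

noncomputable section

set_option linter.dupNamespace false

open scoped Manifold ContDiff Topology
open Set Filter Literature.Geometry.Symplectic Literature.Topology.FourManifolds

namespace Summit.SmoothPoincare4.SmoothPoincare4.Theorems.WitnessCharge.PencilIncompleteness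

/-- **Registered helper `helper_interceptChart_slope`**: the `t`-coordinate of the `w`-chart of a
compactified member at an admissible scale has a SIMPLE zero at `w = 0`, with derivative `lam⁻¹`. -/
theorem helper_interceptChart_slope :
    ∀ (t z : ℂ → ℂ) (lam : ℝ), 4 ≤ lam → t 0 = 0 →
      (∀ w : ℂ, w ≠ 0 → ‖w‖ < 1 → t w = (z ((lam : ℂ) * w⁻¹))⁻¹) →
      (∀ ξ : ℂ, lam / 2 ≤ ‖ξ‖ → ‖z ξ - ξ‖ ≤ 1) →
      HasDerivAt t ((lam : ℂ)⁻¹) 0 := by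
  intro t z lam hlam ht0 ht hz
  rw [hasDerivAt_iff_tendsto_slope_zero]
  have hlam0 : (lam : ℂ) ≠ 0 := by exact_mod_cast (by linarith : lam ≠ 0)
  -- `g w := w * z (lam / w) → lam`
  set g : ℂ → ℂ := fun w => w * z ((lam : ℂ) * w⁻¹) with hg
  have hbound : ∀ w : ℂ, w ≠ 0 → ‖w‖ < 1 → ‖g w - lam‖ ≤ ‖w‖ := by
    intro w hw hw1
    have hwpos : 0 < ‖w‖ := norm_pos_iff.2 hw
    have hξ : lam / 2 ≤ ‖(lam : ℂ) * w⁻¹‖ := by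
      rw [norm_mul, norm_inv, Complex.norm_real, Real.norm_eq_abs, abs_of_nonneg (by linarith)]
      rw [div_le_iff₀ (by norm_num : (0 : ℝ) < 2), mul_assoc]
      have h1 : 1 ≤ ‖w‖⁻¹ * 2 := by
        rw [← div_eq_inv_mul, le_div_iff₀ hwpos]
        linarith
      nlinarith
    have h1 : g w - lam = w * (z ((lam : ℂ) * w⁻¹) - (lam : ℂ) * w⁻¹) := by
      rw [mul_sub, ← mul_assoc, mul_comm w (lam : ℂ), mul_assoc, mul_inv_cancel₀ hw, mul_one]
    rw [h1, norm_mul]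
    calc ‖w‖ * ‖z ((lam : ℂ) * w⁻¹) - (lam : ℂ) * w⁻¹‖ ≤ ‖w‖ * 1 := by
          gcongr
          exact hz _ hξ
      _ = ‖w‖ := mul_one _
  have hne : ∀ᶠ w in 𝓝[≠] (0 : ℂ), w ≠ 0 := self_mem_nhdsWithin
  have hlt : ∀ᶠ w in 𝓝[≠] (0 : ℂ), ‖w‖ < 1 := by
    have h : Metric.ball (0 : ℂ) 1 ∈ 𝓝[≠] (0 : ℂ) :=
      mem_nhdsWithin_of_mem_nhds (Metric.ball_mem_nhds 0 one_pos)
    filter_upwards [h] with w hw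
    exact mem_ball_zero_iff.1 hw
  have hg_tend : Tendsto g (𝓝[≠] 0) (𝓝 (lam : ℂ)) := by
    rw [tendsto_iff_norm_sub_tendsto_zero]
    refine squeeze_zero' (g := fun w : ℂ => ‖w‖) (Eventually.of_forall fun w => norm_nonneg _)
      ?_ ?_
    · filter_upwards [hne, hlt] with w hw hw1
      exact hbound w hw hw1
    · have h : Tendsto (fun w : ℂ => ‖w‖) (𝓝 0) (𝓝 0) := by
        simpa using (continuous_norm.tendsto (0 : ℂ))
      exact h.mono_left nhdsWithin_le_nhds
  refine (hg_tend.inv₀ hlam0).congr' ?_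
  filter_upwards [hne, hlt] with w hw hw1
  rw [zero_add, ht0, sub_zero, smul_eq_mul, ht w hw hw1, hg, ← mul_inv]

/-- **Registered helper `helper_interceptChart_capHolo`**: a `C^∞` `JX`-holomorphic curve with
values in a chart in which `JX` is multiplication by `i` has complex differentiable coordinate
expression (generic over the cap-chart fields of the cap model). -/
theorem helper_interceptChart_capHolo :
    ∀ {X : Type} [TopologicalSpace X] [ChartedSpace (EuclideanSpace ℝ (Fin 4)) X]
      [IsManifold (𝓡 4) ∞ X]
      (JX : ∀ y : X, TangentSpace (𝓡 4) y →L[ℝ] TangentSpace (𝓡 4) y)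
      (capCoord : X → ℂ × ℂ) (capInv : ℂ × ℂ → X) (dom : Set (ℂ × ℂ)),
      IsOpen (capInv '' dom) →
      ContMDiffOn (𝓡 4) 𝓘(ℝ, ℂ × ℂ) ∞ capCoord (capInv '' dom) →
      (∀ q ∈ dom, Function.Bijective (mfderiv 𝓘(ℝ, ℂ × ℂ) (𝓡 4) capInv q)) →
      (∀ q ∈ dom, (mfderiv (𝓡 4) 𝓘(ℝ, ℂ × ℂ) capCoord (capInv q)).comp
          (mfderiv 𝓘(ℝ, ℂ × ℂ) (𝓡 4) capInv q) = ContinuousLinearMap.id ℝ (ℂ × ℂ)) →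
      (∀ q ∈ dom, ∀ v : ℂ × ℂ, JX (capInv q) (mfderiv 𝓘(ℝ, ℂ × ℂ) (𝓡 4) capInv q v) =
          mfderiv 𝓘(ℝ, ℂ × ℂ) (𝓡 4) capInv q (Complex.I • v)) →
      ∀ (γ : ℂ → X) (s : Set ℂ), IsOpen s → ContMDiffOn 𝓘(ℝ, ℂ) (𝓡 4) ∞ γ s →
        Literature.Geometry.Symplectic.IsJHolomorphic (𝓡 4) JX γ → (∀ w ∈ s, γ w ∈ capInv '' dom) →
        DifferentiableOn ℂ (fun w => capCoord (γ w)) s := by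
  intro X _ _ _ JX capCoord capInv dom hopen hcoord hbij hcomp hJcap γ s hs hγ hJ hdom w hw
  have hn : (∞ : WithTop ℕ∞) ≠ 0 := by simp
  obtain ⟨q, hq, hyq⟩ := hdom w hw
  have hγd : MDifferentiableAt 𝓘(ℝ, ℂ) (𝓡 4) γ w :=
    (hγ.contMDiffAt (hs.mem_nhds hw)).mdifferentiableAt hn
  have hcd : MDifferentiableAt (𝓡 4) 𝓘(ℝ, ℂ × ℂ) capCoord (γ w) :=
    (hcoord.contMDiffAt (hopen.mem_nhds (hdom w hw))).mdifferentiableAt hn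
  have hchain : mfderiv 𝓘(ℝ, ℂ) 𝓘(ℝ, ℂ × ℂ) (capCoord ∘ γ) w =
      (mfderiv (𝓡 4) 𝓘(ℝ, ℂ × ℂ) capCoord (γ w)).comp (mfderiv 𝓘(ℝ, ℂ) (𝓡 4) γ w) :=
    mfderiv_comp w hcd hγd
  have hdR : DifferentiableAt ℝ (capCoord ∘ γ) w :=
    mdifferentiableAt_iff_differentiableAt.1 (hcd.comp w hγd)
  -- in the cap chart `JX` is `i`: `d capCoord (JX y u) = i • d capCoord u` at `y = capInv q`
  have hBJ : ∀ y : X, y = capInv q →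
      ∀ (B : TangentSpace (𝓡 4) y →L[ℝ] ℂ × ℂ), B = mfderiv (𝓡 4) 𝓘(ℝ, ℂ × ℂ) capCoord y →
      ∀ u : TangentSpace (𝓡 4) y, B (JX y u) = Complex.I • B u := by
    rintro _ rfl B hB u
    have hBA : ∀ v : ℂ × ℂ, B (mfderiv 𝓘(ℝ, ℂ × ℂ) (𝓡 4) capInv q v) = v := fun v => by
      have h := ContinuousLinearMap.ext_iff.1 (hcomp q hq) v
      rw [hB]
      exact h
    obtain ⟨v, rfl⟩ := (hbij q hq).2 u
    rw [hJcap q hq v, hBA, hBA]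
  have hkey : ∀ ξ : ℂ, fderiv ℝ (capCoord ∘ γ) w ξ =
      (mfderiv (𝓡 4) 𝓘(ℝ, ℂ × ℂ) capCoord (γ w) : TangentSpace (𝓡 4) (γ w) →L[ℝ] ℂ × ℂ)
        (mfderiv 𝓘(ℝ, ℂ) (𝓡 4) γ w ξ) := by
    intro ξ
    rw [← mfderiv_eq_fderiv, hchain]
    rfl
  refine (DifferentiableAt.differentiableWithinAt ?_ : DifferentiableWithinAt ℂ (capCoord ∘ γ) s w)
  rw [differentiableAt_iff_restrictScalars ℝ hdR]
  refine exists_restrictScalars_eq_of_map_mul_I (fderiv ℝ (capCoord ∘ γ) w) fun ζ => ?_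
  rw [hkey, hkey, hJ w ζ]
  exact hBJ (γ w) hyq.symm _ rfl _

end Summit.SmoothPoincare4.SmoothPoincare4.Theorems.WitnessCharge.PencilIncompleteness
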